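import Literature.AlgebraicGeometry.Frobenioids.EquivalenceFrobeniusQuasiIsotropic
import Literature.AlgebraicGeometry.Frobenioids.IsoSubanchorNotIsotropic
import Literature.AlgebraicGeometry.Frobenioids.PreFrobenioidEquivalence
import Literature.AnabelianGeometry.EtaleTheta.BiKummerThm44SubProofs

/-!
# [EtTh] Theorem 4.4: the [FrdI] Theorem 3.4 input (sub-DAG row T44-L03) DERIVED from the tree's
# category-theoreticity theorems — proof-only companion

S. Mochizuki, *The étale theta function …*, Publ. RIMS **45** (2009) [MochizukiEtTh2009], §4, Thm 4.4, proof
PDF p.94 l.−2 – p.95 l.1: "Thus, `Ψ` preserves pre-steps, morphisms of Frobenius type, Frobenius degrees,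
isometries, and base-Frobenius pairs [cf. [FrdI], Theorem 3.4, (ii), (iii) …]".  The sub-DAG row T44-L03
(`Thm44Hyp.PreservesFrobeniusStructure`, `BiKummerThm44Sub.lean`) recorded this as a NAMED INPUT; here it is
DERIVED from abc-iut-L1's kernel-checked [FrdI] Thm 3.4 (iii) over bases of FSM-type
(`FrdI.thm34iii_morphisms_of_isOfFSMType`, `EquivalenceFrobeniusQuasiIsotropic.lean`, abc-iut-L1-t13) — the
tree's REPAIRED VARIANT of the printed route (FSM-type bases instead of FSMFF; the base categories of Thm 4.4
are `B^temp(X^log)[𝒟]`, of FSM-type by [EtTh] Rmk 3.7.2 / [FrdII] Ex 1.3 (i)) — at the hypotheses print uses: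
"`C_i` is a [tempered] Frobenioid" ([FrdI] Thm 5.2 (ii)), "`D_i` of FSM-type" (Rmk 3.7.2), "`Φ_i` non-dilating"
(Thm 4.4 hypothesis), plus [EtTh] Thm 3.7 (i) "isotropic" / "not group-like" (PROVED resp. proved modulo
`IsFrobenioid` in the tree).  Results:
* `preservesFrobeniusStructure_of_thm34` — T44-L03 for `Ψ`;
* `reflectsFrobeniusType_of_thm34` — the Frobenius-type clause for `Ψ⁻¹`, moved back along the unit
  `1 ≅ Ψ⁻¹Ψ` ("for `i = 1, 2`");
* `thm44_i_of_thm34` — **Thm 4.4 (i) ⇐ {`C_i` Frobenioids, `D_i` FSM-type, `Φ_i` non-dilating, T44-L09c, T44-L09}**;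
* `thm44_iii_of_thm34` — **Thm 4.4 (iii) (saturation clause, v5) ⇐ {the same three pairs, T44-L15b}**.
HONEST FRAMING: refereed pre-IUT material; nothing here bears on [IUTchIII] Cor. 3.12; typed ≠ proved — the
remaining named inputs (T44-L09/L09c [SemiAnbd], T44-L15b [FrdII] Def 2.2 (ii)) stay hypotheses, and the
printed generality FSMFF∖FSM of [FrdI] Thm 3.4 is the L1 residual R2 (plan/L1/SUBDAG-FrdI-Thm34.md).
-/

namespace Literature.AnabelianGeometry.EtaleTheta

open CategoryTheory Opposite Literature.AlgebraicGeometry.Frobenioids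

namespace BiKummerSetting

universe u₀ v₀ u v w

variable {K : Type u₀} [Field K] {K' : Type u₀} [Field K'] {D₀ : Type u₀} [Category.{v₀} D₀]
  {V : FrdIMonoidStub.{w}}
  {X₁ : SemiGraphs.TemperedArithmeticGroup.{u₀} K} {X₂ : SemiGraphs.TemperedArithmeticGroup.{u₀} K'}
  {D₀' : Type u₀} [Category.{v₀} D₀']
  {T₁ : RealifiedDivisorMonoids (D₀ := D₀) V} {T₂ : RealifiedDivisorMonoids (D₀ := D₀') V}
  {D₁ D₂ : Type u} [Category.{v} D₁] [Category.{v} D₂] {VD₁ : FrdICatStub.{u, v, w} D₁}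
  {VD₂ : FrdICatStub.{u, v, w} D₂} {S₁ : BiKummerSetting X₁ T₁ D₁ VD₁} {S₂ : BiKummerSetting X₂ T₂ D₂ VD₂}

/-- A tempered Frobenioid that IS a Frobenioid is of quasi-isotropic type in the [FrdI] §3 interface sense
(Thm 3.7 (i) "isotropic", `thm37_i_isotropic_holds`, + [FrdI] Rmk 3.1.1). [cite: MochizukiEtTh2009, Thm 3.7 p.79] -/
theorem isOfQuasiIsotropicType_ofFunctor (S : BiKummerSetting X₁ T₁ D₁ VD₁)
    (hF : PreFrobenioid.IsFrobenioid S.F) :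
    (PreFrobenioidData.ofFunctor S.tf.divisorMonoid S.F).IsOfQuasiIsotropicType :=
  isOfQuasiIsotropicType_of_isOfIsotropicType _ S.F hF
    ⟨fun A => (PreFrobenioidData.ofFunctor_isIsotropic S.F A).2
      (TemperedFrobenioid.thm37_i_isotropic_holds S.tf A)⟩

/-- A tempered Frobenioid that IS a Frobenioid has a non-group-like object (Thm 3.7 (i) "not of group-like
type", `thm37_i_treeClauses_of_isFrobenioid`). [cite: MochizukiEtTh2009, Thm 3.7 p.79] -/
theorem exists_not_isGroupLikeObj_ofFunctor (S : BiKummerSetting X₁ T₁ D₁ VD₁)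
    (hF : PreFrobenioid.IsFrobenioid S.F) :
    ∃ A : S.C, ¬ (PreFrobenioidData.ofFunctor S.tf.divisorMonoid S.F).IsGroupLikeObj A := by
  have h := (TemperedFrobenioid.thm37_i_treeClauses_of_isFrobenioid S.tf hF).2.2
  simp only [PreFrobenioid.IsOfType, not_forall] at h
  obtain ⟨A, hA⟩ := h
  exact ⟨A, fun hA' => hA ((PreFrobenioidData.ofFunctor_isGroupLikeObj S.F A).1 hA')⟩

/-- **T44-L03 DERIVED from [FrdI] Thm 3.4 (iii)** (FSM-variant, abc-iut-L1 `FrdI.thm34iii_morphisms_of_isOfFSMType`):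
for tempered Frobenioids `C₁, C₂` that are Frobenioids, with base categories of FSM-type and non-dilating
divisor monoids, every equivalence `Ψ : C₁ ≌ C₂` preserves Frobenius degrees, isometries, morphisms of
Frobenius type and pull-back morphisms. [cite: MochizukiEtTh2009, Thm 4.4 p.95] -/
theorem Thm44Hyp.preservesFrobeniusStructure_of_thm34 (h : Thm44Hyp S₁ S₂)
    (hF₁ : PreFrobenioid.IsFrobenioid S₁.F) (hF₂ : PreFrobenioid.IsFrobenioid S₂.F)
    (hD₁ : IsOfFSMType D₁) (hD₂ : IsOfFSMType D₂)
    (hnd₁ : (PreFrobenioidData.ofFunctor S₁.tf.divisorMonoid S₁.F).IsNonDilatingOn)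
    (hnd₂ : (PreFrobenioidData.ofFunctor S₂.tf.divisorMonoid S₂.F).IsNonDilatingOn) :
    h.PreservesFrobeniusStructure := by
  obtain ⟨⟨hFT, -, -, -, hpb, hiso, -⟩, ΨN, hΨN, hrefl⟩ :=
    FrdI.thm34iii_morphisms_of_isOfFSMType hF₁ hF₂ (S₁.isOfQuasiIsotropicType_ofFunctor hF₁)
      (S₂.isOfQuasiIsotropicType_ofFunctor hF₂) hD₁ hD₂ hnd₁ hnd₂ h.Ψ
      (S₁.exists_not_isGroupLikeObj_ofFunctor hF₁) (S₂.exists_not_isGroupLikeObj_ofFunctor hF₂)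
  subst hrefl
  refine ⟨fun A B φ => ?_, fun A B φ hφ => ?_, fun A B φ hφ => ?_, fun A B φ hφ => ?_⟩
  · have e := hΨN φ
    rw [PreFrobenioidData.ofFunctor_degFr, PreFrobenioidData.ofFunctor_degFr] at e
    exact e
  · exact (PreFrobenioidData.ofFunctor_isIsometry S₂.F _).1
      (hiso φ ((PreFrobenioidData.ofFunctor_isIsometry S₁.F φ).2 hφ))
  · exact (PreFrobenioidData.ofFunctor_isFrobeniusType S₂.F _).1
      (hFT φ ((PreFrobenioidData.ofFunctor_isFrobeniusType S₁.F φ).2 hφ))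
  · exact (PreFrobenioidData.ofFunctor_isPullbackMorphism S₂.F _).1
      (hpb φ ((PreFrobenioidData.ofFunctor_isPullbackMorphism S₁.F φ).2 hφ))

/-- **"for `i = 1, 2`" — the Frobenius-type clause of [FrdI] Thm 3.4 (iii) for `Ψ⁻¹`**, moved back along the
unit `1 ≅ Ψ⁻¹ ∘ Ψ`: `Ψ` REFLECTS morphisms of Frobenius type. [cite: MochizukiEtTh2009, Thm 4.4 p.95] -/
theorem Thm44Hyp.reflectsFrobeniusType_of_thm34 (h : Thm44Hyp S₁ S₂)
    (hF₁ : PreFrobenioid.IsFrobenioid S₁.F) (hF₂ : PreFrobenioid.IsFrobenioid S₂.F)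
    (hD₁ : IsOfFSMType D₁) (hD₂ : IsOfFSMType D₂)
    (hnd₁ : (PreFrobenioidData.ofFunctor S₁.tf.divisorMonoid S₁.F).IsNonDilatingOn)
    (hnd₂ : (PreFrobenioidData.ofFunctor S₂.tf.divisorMonoid S₂.F).IsNonDilatingOn)
    ⦃A B : S₁.C⦄ (φ : A ⟶ B) (hφ : S₂.IsFrobeniusType (h.Ψ.functor.map φ)) : S₁.IsFrobeniusType φ := by
  obtain ⟨⟨hFT, -⟩, -⟩ :=
    FrdI.thm34iii_morphisms_of_isOfFSMType hF₂ hF₁ (S₂.isOfQuasiIsotropicType_ofFunctor hF₂)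
      (S₁.isOfQuasiIsotropicType_ofFunctor hF₁) hD₂ hD₁ hnd₂ hnd₁ h.Ψ.symm
      (S₂.exists_not_isGroupLikeObj_ofFunctor hF₂) (S₁.exists_not_isGroupLikeObj_ofFunctor hF₁)
  have hback : S₁.IsFrobeniusType ((h.Ψ.functor ⋙ h.Ψ.inverse).map φ) :=
    (PreFrobenioidData.ofFunctor_isFrobeniusType S₁.F _).1
      (hFT (h.Ψ.functor.map φ) ((PreFrobenioidData.ofFunctor_isFrobeniusType S₂.F _).2 hφ))
  have e : φ = ((h.Ψ.unitIso.app A).hom ≫ (h.Ψ.functor ⋙ h.Ψ.inverse).map φ) ≫ (h.Ψ.unitIso.app B).inv :=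
    (Iso.eq_comp_inv _).2 (h.Ψ.unitIso.hom.naturality φ)
  rw [e]
  exact PreFrobenioid.IsFrobeniusType.comp_iso hF₁.isPreFrobenioid
    (PreFrobenioid.IsFrobeniusType.iso_comp hF₁.isPreFrobenioid _ hback) _

/-- **Thm 4.4 (i) with T44-L03 discharged**: `Thm44_i h` from "`C₁, C₂` are Frobenioids" ([FrdI] Thm 5.2 (ii)),
"`D₁, D₂` of FSM-type" (Rmk 3.7.2), "`Φ₁, Φ₂` non-dilating" (hypothesis of Thm 4.4, in [FrdI] vocabulary), and
the [SemiAnbd] inputs T44-L09c, T44-L09. [cite: MochizukiEtTh2009, Thm 4.4 p.94] -/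
theorem Thm44Hyp.thm44_i_of_thm34 (h : Thm44Hyp S₁ S₂)
    (hF₁ : PreFrobenioid.IsFrobenioid S₁.F) (hF₂ : PreFrobenioid.IsFrobenioid S₂.F)
    (hD₁ : IsOfFSMType D₁) (hD₂ : IsOfFSMType D₂)
    (hnd₁ : (PreFrobenioidData.ofFunctor S₁.tf.divisorMonoid S₁.F).IsNonDilatingOn)
    (hnd₂ : (PreFrobenioidData.ofFunctor S₂.tf.divisorMonoid S₂.F).IsNonDilatingOn)
    (h9c : h.GaloisCompatible) (h9 : h.HodotCompatible) : Thm44_i h :=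
  h.thm44_i_of_inputs hF₂ (h.preservesFrobeniusStructure_of_thm34 hF₁ hF₂ hD₁ hD₂ hnd₁ hnd₂) h9c h9

/-- **Thm 4.4 (iii) (saturation clause, v5) with T44-L03 and its `Ψ⁻¹`-twin discharged**: `Thm44_iii h ψ` from
"`C₁, C₂` Frobenioids", "`D₁, D₂` FSM-type", "`Φ₁, Φ₂` non-dilating" and the [FrdII] Def 2.2 (ii) input
T44-L15b. [cite: MochizukiEtTh2009, Thm 4.4 p.94] -/
theorem Thm44Hyp.thm44_iii_of_thm34 (h : Thm44Hyp S₁ S₂)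
    (ψ : ∀ A : S₁.C, S₁.biratUnits A ≃* S₂.biratUnits (h.Ψ.functor.obj A))
    (hF₁ : PreFrobenioid.IsFrobenioid S₁.F) (hF₂ : PreFrobenioid.IsFrobenioid S₂.F)
    (hD₁ : IsOfFSMType D₁) (hD₂ : IsOfFSMType D₂)
    (hnd₁ : (PreFrobenioidData.ofFunctor S₁.tf.divisorMonoid S₁.F).IsNonDilatingOn)
    (hnd₂ : (PreFrobenioidData.ofFunctor S₂.tf.divisorMonoid S₂.F).IsNonDilatingOn)
    (h15 : h.PreservesNHSaturatedBsFld) : Thm44_iii h ψ :=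
  h.thm44_iii_of_inputs ψ (h.preservesFrobeniusStructure_of_thm34 hF₁ hF₂ hD₁ hD₂ hnd₁ hnd₂)
    (h.reflectsFrobeniusType_of_thm34 hF₁ hF₂ hD₁ hD₂ hnd₁ hnd₂) hF₂ h15

end BiKummerSetting

end Literature.AnabelianGeometry.EtaleTheta
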